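import Summits.AnomalousDissipation.AnomalousDissipation.Theorems.SolenoidalFractalHomogenisationLagrangianStepD1TailBoundDiag
import Summits.AnomalousDissipation.AnomalousDissipation.Theorems.SolenoidalFractalHomogenisationLagrangianStepD1TailBoundFar
import HarnessLib

/-!
# K1L_D `stub_D1_residueTail` (registry v17, stmt-AnomalousDissipation-27980) — lane A4 `hbound`, CASE E: ADJACENT NON-COLINEAR SLOT PAIRS
# (`2l+1 → 2l+2` and the wrap pair `25 → 0`): the fresh injection is invisible to the pickup, the visible part crossed the whole source slot
# (helper; `--supports stmt-AnomalousDissipation-27980`)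

Summits-side helper file of route `SolenoidalFractalHomogenisation` (prover seat `ad-sawtooth-k1loc-p1` g13, lane A owner; case E of the tail certificate
`Lines/onelevel-D1-tail-cert.md` §3 — the "one new analytic input", engine `Sideband.norm_maskL_offLadder_le` p697915).  Everything proved; no definitions,
no named facts, no sorry.
* `ne_smul_of_minor_ne_zero`, `cubature_adj_minor`, `cubature_wrap_minor` — non-colinearity of consecutive directions of the cubature word (a `2×2` minor);
* `freshMat_eq_zero'` — no fresh part unless diagonal or forward colinear pair;
* **`tail_bound_caseE_core`** — for `j ≠ j'`, not a forward pair, `startⱼ + pP₁ = start_{j'} + τ¹_{j'}`, `m_{j'} ∉ ℤmⱼ`: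
  `|tailKernel ν S p q j j'| ≤ gTail j j'·√PpSq_j(p)·√PpSq_{j'}(q)` (pickup reads through the off-ladder mask; masked state `≤ e^{−θ_{j'}}·sup ≤ e^{−θmin}·Bst…`);
* **`tail_bound_caseE_inner`** (`(j,j') = (2l+2, 2l+1)`, `p = 0`) and **`tail_bound_caseE_wrap`** (`(j,j') = (0,25)`, `p = 1`).
NOT a proof of the registered stub, of the crux, or of anomalous dissipation; rung leaf F-D1 infrastructure.
-/

set_option linter.dupNamespace false

noncomputable section

namespace Summit.AnomalousDissipation.AnomalousDissipation.Theorems.SolenoidalFractalHomogenisation.LagrangianStep.D1Tail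

open Summit.AnomalousDissipation.AnomalousDissipation.Theorems
open Summit.AnomalousDissipation.AnomalousDissipation.Theorems.SolenoidalFractalHomogenisation.LagrangianStep
open Summit.AnomalousDissipation.AnomalousDissipation.Theorems.SolenoidalFractalHomogenisation.LagrangianStep.WCrossing
open Summit.AnomalousDissipation.AnomalousDissipation.Theorems.SolenoidalFractalHomogenisation.LagrangianStep.D1ResidueCert
open Summit.AnomalousDissipation.AnomalousDissipation.Theorems.SolenoidalFractalHomogenisation.LagrangianStep.D1TailCert
open Summit.AnomalousDissipation.AnomalousDissipation.Theorems.SolenoidalFractalHomogenisation.LagrangianStep.Sideband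
open Summit.AnomalousDissipation.AnomalousDissipation.Theorems.SolenoidalFractalHomogenisation.LagrangianStep.CellChain (start_stretch_stretch)
open Summit.AnomalousDissipation.AnomalousDissipation.Theorems.SolenoidalFractalHomogenisation.PermissibleCarrier
  (period_pos start_nonneg start_add_tau_le_period)
open Summit.AnomalousDissipation.AnomalousDissipation.Theorems.SolenoidalFractalHomogenisation.RealisedQuasiStaticCellLaw (start_add_tau_le_start)
open Literature.Analysis Literature.Analysis.FluidPDE Literature.Analysis.FunctionSpaces Literature.Analysis.FunctionSpaces.Torus
open Literature.Analysis.FluidPDE.Torus Literature.Analysis.FluidPDE.LatticeShear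
open Set Real Complex MeasureTheory intervalIntegral
open scoped InnerProductSpace

/-! ## §1 Non-colinearity of consecutive directions -/

/-- A nonzero `2×2` minor forbids `m' ∈ ℤm`. [folklore] -/
theorem ne_smul_of_minor_ne_zero {m m' : Fin 3 → ℤ}
    (h : m 0 * m' 1 - m 1 * m' 0 ≠ 0 ∨ m 0 * m' 2 - m 2 * m' 0 ≠ 0 ∨ m 1 * m' 2 - m 2 * m' 1 ≠ 0) : ∀ c : ℤ, m' ≠ c • m := by
  intro c hc
  have e : ∀ i, m' i = c * m i := fun i => by rw [hc]; rfl
  rcases h with h | h | h <;> apply h <;> simp only [e] <;> ring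

/-- Consecutive directions `2l+1 → 2l+2` of the cubature word are non-colinear (a nonzero minor). [folklore] -/
theorem cubature_adj_minor (l : Fin 12) :
    let m := (slots ⟨2 * (l.val + 1), by have := l.isLt; omega⟩).m
    let m' := (slots ⟨2 * l.val + 1, by have := l.isLt; omega⟩).m
    m 0 * m' 1 - m 1 * m' 0 ≠ 0 ∨ m 0 * m' 2 - m 2 * m' 0 ≠ 0 ∨ m 1 * m' 2 - m 2 * m' 1 ≠ 0 := by
  revert l; decide

/-- The wrap pair `25 → 0` is non-colinear. [folklore] -/
theorem cubature_wrap_minor :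
    let m := (slots 0).m
    let m' := (slots 25).m
    m 0 * m' 1 - m 1 * m' 0 ≠ 0 ∨ m 0 * m' 2 - m 2 * m' 0 ≠ 0 ∨ m 1 * m' 2 - m 2 * m' 1 ≠ 0 := by
  decide

/-- No fresh part unless diagonal or forward colinear pair. [cite: ArmstrongVicol2025, §3] -/
theorem freshMat_eq_zero' (S : T4) {j j' : Fin 26} (hne : j ≠ j') (hnp : ∀ l, ¬(j = sndSlot l ∧ j' = fstSlot l)) : freshMat S j j' = 0 := by
  rw [freshMat_def, if_neg hne, zero_add]
  exact Finset.sum_eq_zero fun l _ => if_neg (hnp l)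

/-! ## §2 The adjacent non-colinear core -/

/-- **CASE E CORE.**  `ν ∈ (0,1/40]`, `NearIso S (10/11) (11/10)`; pickup slot `j`, source slot `j' ≠ j`, not a forward colinear pair, adjacent up to a period shift
(`startⱼ + pP₁ = start_{j'} + τ¹_{j'}`), non-colinear (`m_{j'} ∉ ℤmⱼ`): `|tailKernel ν S p q j j'| ≤ gTail j j'·(√PpSq_j(p)·√PpSq_{j'}(q))`.
[cite: ArmstrongVicol2025, §3] [cite: SandersVerhulstMurdock2007, Lemma 5.2.7] [cite: MeshalkinSinai1961, pp. 1700–1705] -/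
theorem tail_bound_caseE_core {ν : ℝ} (hν : ν ∈ Ioc (0:ℝ) (1 / 40)) {S : T4} (hS : Torus.NearIso S (10 / 11) (11 / 10)) (p q : Fin 3 → ℝ)
    {j j' : Fin 26} (hjj : j ≠ j') (hnp : ∀ l, ¬(j = sndSlot l ∧ j' = fstSlot l)) (pz : ℤ)
    (hadj : ((cubatureWord.stretch MB MB_pos).stretch (1 / ν) (one_div_pos.mpr hν.1)).start j +
      pz * ((cubatureWord.stretch MB MB_pos).stretch (1 / ν) (one_div_pos.mpr hν.1)).period =
      ((cubatureWord.stretch MB MB_pos).stretch (1 / ν) (one_div_pos.mpr hν.1)).start j' +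
        (((cubatureWord.stretch MB MB_pos).stretch (1 / ν) (one_div_pos.mpr hν.1)).phase j').τ)
    (hnc : ∀ c : ℤ, (cubatureWord.phase j').m ≠ c • (cubatureWord.phase j).m) :
    |tailKernel ν S p q j j'| ≤ gTail j j' * (Real.sqrt (PpSq j p) * Real.sqrt (PpSq j' q)) := by
  have hν' := hν
  obtain ⟨hν0, hν40⟩ := hν'
  set W₁ := (cubatureWord.stretch MB MB_pos).stretch (1 / ν) (one_div_pos.mpr hν0) with hW₁
  have h𝔸 : Torus.NearIso (ν • S) (ν * (10 / 11)) (ν * (11 / 10)) := hS.smul hν0.le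
  have hlo : 0 < ν * (10 / 11) := by positivity
  set r := min (1:ℝ) (4 * π ^ 2 * (ν * (10 / 11))) with hr
  have hr0 : 0 ≤ r := le_min zero_le_one (by positivity)
  have hrmin : r = 4 * π ^ 2 * (ν * (10 / 11)) := min_one_viscRate ⟨hν0, hν40⟩
  have hNj' := isPeriodicResponse_cubature hν0 hS j'
  set N := response W₁ (ν • S) 1 (R0 ν) j' with hNdef
  set Nb := responseExt W₁ (ν • S) 1 (R0 ν) j' with hNb
  set pC : EuclideanSpace ℂ (Fin 3) := WithLp.toLp 2 fun i => ((p i : ℝ) : ℂ) with hpC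
  set qC : EuclideanSpace ℂ (Fin 3) := WithLp.toLp 2 fun i => ((q i : ℝ) : ℂ) with hqC
  set s := W₁.start j with hs
  set s' := W₁.start j' with hs'
  set L := (W₁.phase j).τ with hL
  set L' := (W₁.phase j').τ with hL'
  have hLpos : 0 < L := (W₁.phase j).τ_pos
  have hs0 : 0 ≤ s := start_nonneg W₁ j
  have hsP : s + L ≤ W₁.period := start_add_tau_le_period W₁ j
  set m := (W₁.phase j).m with hm
  set m' := (W₁.phase j').m with hm'
  set A₂ : Set (Fin 3 → ℤ) := {z | ∀ d : ℤ, z ≠ m' + d • m ∧ z ≠ -m' + d • m} with hA₂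
  have hmA : m ∈ A₂ := self_mem_offLadder hnc
  have hmA' : -m ∈ A₂ := neg_self_mem_offLadder hnc
  set SUP : ℝ := 8 * π * ‖slotAmp W₁ j'‖ / r * ‖transversalProj (cubatureWord.phase j').m qC‖ with hSUP
  have hSUP0 : 0 ≤ SUP := by rw [hSUP]; positivity
  have hθ : Real.exp (-(r * L')) ≤ Real.exp (-θmin) := by
    refine le_trans (le_of_eq ?_) (exp_neg_θs_le j')
    rw [hrmin, hL', hW₁, tau_stretch_stretch cubatureWord MB_pos hν0 j', viscRate_mul_slotLen hν0 j']
  -- the masked state in the pickup slot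
  have hmask : ∀ t ∈ Icc s (s + L), ‖maskL (R0 ν) A₂ (N t qC)‖ ≤ Real.exp (-θmin) * SUP := by
    intro t ht
    have htP : t ∈ Icc 0 W₁.period := ⟨hs0.trans ht.1, ht.2.trans hsP⟩
    have hshift : N t qC = Nb (t + pz * W₁.period) qC := by
      rw [hNdef, response_eq_responseExt W₁ (ν • S) 1 (R0 ν) j' hNj' htP, hNb, ← responseExt_sub_zsmul W₁ (ν • S) 1 (R0 ν) j' (t + pz * W₁.period) pz,
        zsmul_eq_mul, add_sub_cancel_right]
    rw [hshift]
    have h := norm_maskL_offLadder_le W₁ h𝔸 hlo.le zero_le_one (R0 ν) hjj hNj' pz hadj qC ht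
    have hsup : ‖Nb s' qC‖ ≤ SUP := norm_responseExt_apply_le W₁ h𝔸 hlo one_pos (R0 ν) j' s' qC
    exact h.trans (mul_le_mul hθ hsup (norm_nonneg _) (Real.exp_pos _).le)
  -- pointwise pairing bound
  have hpt : ∀ t ∈ Set.uIoc s (s + L), ‖⟪pC, feedback W₁ (R0 ν) j t (N t qC)⟫_ℂ‖ ≤
      1 / (2 * ‖latticeVec (cubatureWord.phase j).m‖) * ‖transversalProj (cubatureWord.phase j).m pC‖ * (2 * (Real.exp (-θmin) * SUP)) := by
    intro t ht
    rw [Set.uIoc_of_le (by linarith)] at ht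
    have ht' : t ∈ Icc s (s + L) := ⟨ht.1.le, ht.2⟩
    have htP : t ∈ Icc 0 W₁.period := ⟨hs0.trans ht'.1, ht'.2.trans hsP⟩
    rw [← feedback_maskL_of_mem W₁ (R0 ν) j t hmA hmA' (N t qC)]
    have hfa : transversalProj (W₁.phase j).m (coordL (R0 ν) (-(W₁.phase j).m) (maskL (R0 ν) A₂ (N t qC))) =
        coordL (R0 ν) (-(W₁.phase j).m) (maskL (R0 ν) A₂ (N t qC)) := by
      rw [coordL_maskL_of_mem hmA']
      exact transversalProj_coordL_response W₁ h𝔸 hlo one_pos (R := R0 ν) j' htP qC _ _ (Or.inr rfl)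
    have hfb : transversalProj (W₁.phase j).m (coordL (R0 ν) (W₁.phase j).m (maskL (R0 ν) A₂ (N t qC))) =
        coordL (R0 ν) (W₁.phase j).m (maskL (R0 ν) A₂ (N t qC)) := by
      rw [coordL_maskL_of_mem hmA]
      exact transversalProj_coordL_response W₁ h𝔸 hlo one_pos (R := R0 ν) j' htP qC _ _ (Or.inl rfl)
    have hpick := norm_inner_feedback_le W₁ (R0 ν) j t pC hfa hfb
    have hy1 : ‖coordL (R0 ν) (-(W₁.phase j).m) (maskL (R0 ν) A₂ (N t qC))‖ ≤ Real.exp (-θmin) * SUP := (norm_coordL_le _ _).trans (hmask t ht')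
    have hy2 : ‖coordL (R0 ν) (W₁.phase j).m (maskL (R0 ν) A₂ (N t qC))‖ ≤ Real.exp (-θmin) * SUP := (norm_coordL_le _ _).trans (hmask t ht')
    have h0 : 0 ≤ 1 / (2 * ‖latticeVec (W₁.phase j).m‖) * ‖transversalProj (W₁.phase j).m pC‖ := by positivity
    calc ‖⟪pC, feedback W₁ (R0 ν) j t (maskL (R0 ν) A₂ (N t qC))⟫_ℂ‖
        ≤ 1 / (2 * ‖latticeVec (W₁.phase j).m‖) * ‖transversalProj (W₁.phase j).m pC‖ *
            (‖coordL (R0 ν) (-(W₁.phase j).m) (maskL (R0 ν) A₂ (N t qC))‖ + ‖coordL (R0 ν) (W₁.phase j).m (maskL (R0 ν) A₂ (N t qC))‖) := hpick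
      _ ≤ 1 / (2 * ‖latticeVec (W₁.phase j).m‖) * ‖transversalProj (W₁.phase j).m pC‖ * (2 * (Real.exp (-θmin) * SUP)) :=
            mul_le_mul_of_nonneg_left (by linarith) h0
      _ = _ := rfl
  -- the decomposition (no fresh part)
  have hI := intervalIntegrable_feedback_comp W₁ (ν • S) 1 (R0 ν) j j' hNj' hs0 (by linarith) hsP
  have hXint : IntervalIntegrable (fun t => feedback W₁ (R0 ν) j t (N t qC)) volume s (s + L) := by
    have h := ((continuousOn_feedback_comp W₁ (ν • S) 1 (R0 ν) j j' hNj').mono (Icc_subset_Icc hs0 hsP)).clm_apply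
      (continuousOn_const (c := qC))
    exact (h.congr fun t _ => rfl).intervalIntegrable_of_Icc (by linarith)
  have hMq : meanFeedback W₁ (ν • S) 1 (R0 ν) j j' qC = (1 / W₁.period) • ∫ t in s..s + L, feedback W₁ (R0 ν) j t (N t qC) := by
    rw [meanFeedback_eq_slot_integral W₁ (ν • S) 1 (R0 ν) j j' ⟨_, hNj'⟩, _root_.smul_apply, ContinuousLinearMap.intervalIntegral_apply hI qC]
    exact congrArg _ (intervalIntegral.integral_congr fun t _ => rfl)
  have h0 : (0 : Matrix (Fin 3) (Fin 3) ℝ).map ((↑) : ℝ → ℂ) = 0 := by ext i j; simp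
  have hM : ν / (4 * π ^ 2) * (⟪pC, meanFeedback W₁ (ν • S) 1 (R0 ν) j j' qC⟫_ℂ).re -
      (⟪pC, Matrix.toEuclideanCLM (n := Fin 3) (𝕜 := ℂ) ((freshMat S j j').map ((↑) : ℝ → ℂ)) qC⟫_ℂ).re =
      ν / (4 * π ^ 2) * (⟪pC, (1 / W₁.period) • ∫ t in s..s + L, feedback W₁ (R0 ν) j t (N t qC)⟫_ℂ).re := by
    rw [hMq, freshMat_eq_zero' S hjj hnp, h0, map_zero, _root_.zero_apply, inner_zero_right, Complex.zero_re, sub_zero]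
  exact tail_bound_of_decomp hν S p q j j' _ hXint hM hpt

/-! ## §3 The two adjacent non-colinear families -/

/-- **CASE E, inner pairs** `(j, j') = (2l+2, 2l+1)`, `l < 12`. [cite: ArmstrongVicol2025, §3] -/
theorem tail_bound_caseE_inner {ν : ℝ} (hν : ν ∈ Ioc (0:ℝ) (1 / 40)) {S : T4} (hS : Torus.NearIso S (10 / 11) (11 / 10)) (p q : Fin 3 → ℝ)
    (l : Fin 12) :
    |tailKernel ν S p q ⟨2 * (l.val + 1), by have := l.isLt; omega⟩ ⟨2 * l.val + 1, by have := l.isLt; omega⟩| ≤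
      gTail ⟨2 * (l.val + 1), by have := l.isLt; omega⟩ ⟨2 * l.val + 1, by have := l.isLt; omega⟩ *
        (Real.sqrt (PpSq ⟨2 * (l.val + 1), by have := l.isLt; omega⟩ p) * Real.sqrt (PpSq ⟨2 * l.val + 1, by have := l.isLt; omega⟩ q)) := by
  set j : Fin 26 := ⟨2 * (l.val + 1), by have := l.isLt; omega⟩ with hj
  set j' : Fin 26 := ⟨2 * l.val + 1, by have := l.isLt; omega⟩ with hj'
  set W₁ := (cubatureWord.stretch MB MB_pos).stretch (1 / ν) (one_div_pos.mpr hν.1) with hW₁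
  have hjj : j ≠ j' := by intro h; have := congrArg Fin.val h; simp [hj, hj'] at this; omega
  have hnp : ∀ l', ¬(j = sndSlot l' ∧ j' = fstSlot l') := by
    rintro l' ⟨h1, _⟩
    have := congrArg Fin.val h1
    simp [hj, sndSlot] at this
    omega
  have hsucc' : j'.val + 1 < 26 := by simp [hj']; have := l.isLt; omega
  have hjs : j = ⟨j'.val + 1, hsucc'⟩ := Fin.ext (by simp [hj, hj']; ring)
  have hadj : W₁.start j + (0 : ℤ) * W₁.period = W₁.start j' + (W₁.phase j').τ := by
    rw [Int.cast_zero, zero_mul, add_zero, hjs]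
    exact start_succ W₁ j' hsucc'
  have hnc : ∀ c : ℤ, (cubatureWord.phase j').m ≠ c • (cubatureWord.phase j).m := ne_smul_of_minor_ne_zero (cubature_adj_minor l)
  exact tail_bound_caseE_core hν hS p q hjj hnp 0 hadj hnc

/-- **CASE E, the wrap pair** `(j, j') = (0, 25)`. [cite: ArmstrongVicol2025, §3] -/
theorem tail_bound_caseE_wrap {ν : ℝ} (hν : ν ∈ Ioc (0:ℝ) (1 / 40)) {S : T4} (hS : Torus.NearIso S (10 / 11) (11 / 10)) (p q : Fin 3 → ℝ) :
    |tailKernel ν S p q 0 25| ≤ gTail 0 25 * (Real.sqrt (PpSq 0 p) * Real.sqrt (PpSq 25 q)) := by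
  set W₁ := (cubatureWord.stretch MB MB_pos).stretch (1 / ν) (one_div_pos.mpr hν.1) with hW₁
  have hjj : (0 : Fin 26) ≠ 25 := by decide
  have hnp : ∀ l', ¬((0 : Fin 26) = sndSlot l' ∧ (25 : Fin 26) = fstSlot l') := by
    rintro l' ⟨h1, _⟩
    have := congrArg Fin.val h1
    simp [sndSlot] at this
  have hadj : W₁.start 0 + (1 : ℤ) * W₁.period = W₁.start 25 + (W₁.phase 25).τ := by
    rw [Int.cast_one, one_mul, start_zero, zero_add]
    exact period_eq_start_last W₁
  have hnc : ∀ c : ℤ, (cubatureWord.phase 25).m ≠ c • (cubatureWord.phase 0).m := ne_smul_of_minor_ne_zero cubature_wrap_minor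
  exact tail_bound_caseE_core hν hS p q hjj hnp 1 hadj hnc

end Summit.AnomalousDissipation.AnomalousDissipation.Theorems.SolenoidalFractalHomogenisation.LagrangianStep.D1Tail

end
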